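import Summits.QuantumFields.BalabanUV.T4Continuum.Support.ShellMeasureGradientTailLevels

/-!
# `T4Continuum.ShellMeasureMultiGridNorms` — the (Ω_j)-WEIGHTED SUP NORMS `|·|_{(−α)}` of [Balaban1985Variational] AS
# NORMED SPACES (data), and (P4)'s (98) SHAPE for the `∇`-free plaquette part stated LITERALLY as
# `B11Prop6Scheme.Prop4Hyp` between them
# (cell `pub-balaban`, sub-cell `t4`, spine estimate NE7c (node U5b), crew lineage `b2b-balaban-t4-ne7c-formalise-leaf-02`
# gen 8, owner table `LEAVES-NE7c-P1.md` row S65 file f2a; imports this lineage's f2b `ShellMeasureGradientTailLevels`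
# (hence the owner's S62 f1 `ShellMeasureLocalGradientTail` and `B11Prop6Scheme.Prop4Hyp`) ONLY; [folklore]; 0 sorry)

HONEST FRAMING.  Finite four-torus programme, rung (B)+1 only — NOT infinite volume, NOT a mass gap, NOT the Clay
problem, NOT summit progress; (B), `BetaPertHyp`, (B^μ) are not consumed.  NE7c (`T4IndicatorShell.ShellWeightBound`)
is NOT PRINTED and NOT PROVED; «NE7c ⇐ the named binders» (WALL `t4/b2b-balaban-t4-ne7c-p1/WALL-NE7c-P1.md` §2).
WEIGHTED-ℓ^∞ BOOKKEEPING on a finite product ([folklore]); nothing printed is asserted or cited as a fact; no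
`def … : Prop` is minted (the `def`s are DATA: a type synonym, its scaling map, two identity maps).  HONEST DEPENDENCY
(cell): continuum YM on T⁴ ⇐ BetaPertH ∧ nine spine estimates (0/9 proved); BetaPertH ⇐ (D1) ∧ (D4) ∧ CAP+tail;
G-an2-4 gates asym, D1 and NE2/3/4.

THE POINT (locator `HOME/b2b-balaban-t4-ne7c-formalise-leaf-02/XREAD-P4-B11-SectB.md` §3 (i), GAPS C-ne7cleaf02g8-1
(c)).  Print displays ONE weighted norm, p. 286 (verbatim, LOCATOR ONLY — the paper is under adjudication): *«… we
can take it arbitrarily close to sup_j Lʲη sup_{Ω_j}|A′| = |A′|_{(−1)}»*; `|∇A′|_{(−2)}` and `|(δ∕δA′)V|_{(−3)}` of (98)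
follow the same pattern (a READING, unambiguous from (19)∕(43)∕(77)∕(97)).  Since `Ω₀ ⊃ Ω₁ ⊃ … ⊃ Ω_k`, a bond carries
the weight `w(b) = L^{j(b)}η`, `j(b) = max{j : b ∈ Ω_j}`, and `|A|_{(−α)} = sup_b w(b)^α·‖A(b)‖`: a weighted sup norm
on a FINITE product.  END-II's binder `hW : ∀ V, Prop4Hyp (W𝒱 V) C₄ a₃` is typed between NORMED spaces `𝒴 → 𝒵`, so to
state (98) literally one needs these norms as `NormedAddCommGroup` ∕ `NormedSpace ℂ` structures.  WHAT THIS FILE DOES: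
* §1 the type synonym `WSup w α 𝔄 := Λ → 𝔄` (bond fields read with the weight `w : Λ → ℝ`, exponent `α : ℕ`), its
  vector-space structure (that of `Λ → 𝔄`), the scaling map `scale w α : A ↦ (b ↦ (w b)^α • A b)` into the flat
  sup-normed `Λ → 𝔄`, and — for POSITIVE weights, `[Fact (∀ b, 0 < w b)]` — the norm INDUCED along `scale`
  (`NormedAddCommGroup.induced`, `NormedSpace.induced`: no axiom is checked by hand), so that `‖A‖ = sup_b (w b)^α·‖A b‖`
  (`norm_apply_le`, `norm_le_iff`, `norm_lt_iff` — the last is (97) ⇔ (98): «`< C` on Ω_j with the weight `(Lʲη)^{−α}`»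
  ⇔ «weighted sup `< C`»);
* §2 the identity as a continuous linear equivalence `WSup w α 𝔄 ≃L[ℂ] (Λ → 𝔄)` (`toPiL`; both directions bounded —
  finite volume —, so `DifferentiableOn` TRANSFERS between weighted and flat coordinates: the weighted spaces have the
  SAME analytic functions as the flat one, only the constants of (98) see the weights);
* §3 **`prop4Hyp_locGrad_levels`**: the lineage's f2b `ShellMeasureGradientTailLevels.weighted_locGrad_le` +
  `differentiableOn_locGrad_wBall` READ AS `Prop4Hyp (locGrad (Σ_p φ_p)) (8κ·m·Lc⁴) (ε∕2)` from `WSup w 1 𝔄` (fields,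
  `|·|_{(−1)}`) to `WSup w 3 (𝔄 →L[ℂ] ℂ)` (gradient fields, `|·|_{(−3)}`) — END-II's `hW` SHAPE at the live levels for
  the `∇`-free plaquette part, constant VOLUME-FREE and k-UNIFORM;
* §4 `Prop4Hyp.comp_of_norm_le`: a `Prop4Hyp` bound survives pre-composition with a norm-non-increasing linear map —
  the bookkeeping by which the `|·|_{(−1)}`-statement of §3 becomes the `max{|·|_{(−1)}, |∇·|_{(−2)}}`-statement of (98)
  once the `∇`-datum is fixed (the max-normed space maps norm-non-increasingly to `WSup w 1`); the `∇`-part itself is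
  NOT here (locator §3 (j)–(k); it needs a concrete covariant lattice calculus).
NOT HERE: the `∇`-part of (98), the HD-dressing (row S66), the identification with Bałaban's objects (node O).  So this
file is TYPING + one packaging theorem; no estimate of Bałaban's is discharged.
-/

noncomputable section

open Metric Set Function

namespace Summit.QuantumFields.BalabanUV.T4Continuum.ShellMeasureMultiGridNorms

open Literature.MathematicalPhysics.QuantumFieldTheory.Balaban1983to89
open B11Prop6Scheme (Prop4Hyp)
open Summit.QuantumFields.BalabanUV.T4Continuum.ShellMeasureLocalGradientTail (locGrad)
open Summit.QuantumFields.BalabanUV.T4Continuum.ShellMeasureGradientTailLevels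
  (weighted_locGrad_le differentiableOn_locGrad_wBall)

variable {Λ : Type*} [Fintype Λ] {𝔄 : Type*} [NormedAddCommGroup 𝔄] [NormedSpace ℂ 𝔄]

/-! ## §1 The weighted bond-field space `WSup w α 𝔄` and its induced norm `sup_b (w b)^α·‖A b‖` -/

/-- Bond fields `Λ → 𝔄` READ WITH THE WEIGHT `(w b)^α` — a type synonym (for Bałaban: `w b = L^{j(b)}η`, α = 1 for
fields, 2 for their covariant derivatives, 3 for gradients∕currents). [folklore] -/
@[nolint unusedArguments]
def WSup (_w : Λ → ℝ) (_α : ℕ) (𝔄 : Type*) : Type _ := Λ → 𝔄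

namespace WSup

variable (w : Λ → ℝ) (α : ℕ)

/-- The additive group structure of `WSup w α 𝔄` is that of `Λ → 𝔄`. [folklore] -/
instance instAddCommGroup : AddCommGroup (WSup w α 𝔄) := inferInstanceAs (AddCommGroup (Λ → 𝔄))

/-- The `ℂ`-module structure of `WSup w α 𝔄` is that of `Λ → 𝔄`. [folklore] -/
instance instModuleComplex : Module ℂ (WSup w α 𝔄) := inferInstanceAs (Module ℂ (Λ → 𝔄))

/-- The identity `WSup w α 𝔄 → (Λ → 𝔄)` (forget the weight), linear. [folklore] -/
def toPi : WSup w α 𝔄 ≃ₗ[ℂ] (Λ → 𝔄) := LinearEquiv.refl ℂ (Λ → 𝔄)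

omit [Fintype Λ] in
/-- `toPi` is the identity on underlying functions. [folklore] -/
theorem toPi_apply (A : WSup w α 𝔄) (b : Λ) : toPi w α A b = A b := rfl

omit [Fintype Λ] in
/-- `toPi.symm` is the identity on underlying functions. [folklore] -/
theorem toPi_symm_apply (A : Λ → 𝔄) (b : Λ) : ((toPi w α).symm A : WSup w α 𝔄) b = A b := rfl

/-- THE SCALING MAP `A ↦ (b ↦ (w b)^α • A b)` into the flat sup-normed space (complex scalar `((w b : ℂ))^α`, so that no
real-scalar structure on `𝔄` is needed). [folklore] -/
def scale : WSup w α 𝔄 →ₗ[ℂ] (Λ → 𝔄) where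
  toFun A := fun b => ((w b : ℂ) ^ α) • A b
  map_add' A B := by
    funext b
    change ((w b : ℂ) ^ α) • (A b + B b) = _
    rw [smul_add]
    rfl
  map_smul' c A := by
    funext b
    change ((w b : ℂ) ^ α) • (c • A b) = c • (((w b : ℂ) ^ α) • A b)
    rw [smul_comm]

omit [Fintype Λ] in
/-- Unfolding. [folklore] -/
theorem scale_apply (A : WSup w α 𝔄) (b : Λ) : scale w α A b = ((w b : ℂ) ^ α) • A b := rfl

omit [Fintype Λ] in
/-- The norm of one scaled component: `‖scale A b‖ = |w b|^α · ‖A b‖`. [folklore] -/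
theorem norm_scale_apply (A : WSup w α 𝔄) (b : Λ) : ‖scale w α A b‖ = |w b| ^ α * ‖A b‖ := by
  rw [scale_apply, norm_smul, norm_pow, Complex.norm_real, Real.norm_eq_abs]

variable [hw : Fact (∀ b, 0 < w b)]

omit [Fintype Λ] in
/-- For positive weights the scaling map is injective. [folklore] -/
theorem scale_injective : Injective (scale w α : WSup w α 𝔄 → (Λ → 𝔄)) := by
  intro A B h
  funext b
  have hb : ((w b : ℂ) ^ α) • A b = ((w b : ℂ) ^ α) • B b := by
    simpa only [scale_apply] using congr_fun h b
  have hne : ((w b : ℂ) ^ α) ≠ 0 := pow_ne_zero α (by exact_mod_cast (hw.out b).ne')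
  exact smul_right_injective 𝔄 hne hb

/-- THE WEIGHTED SUP NORM, INDUCED along `scale` from the flat sup norm: `‖A‖ = sup_b (w b)^α·‖A b‖`. [folklore] -/
instance instNormedAddCommGroup : NormedAddCommGroup (WSup w α 𝔄) :=
  NormedAddCommGroup.induced (WSup w α 𝔄) (Λ → 𝔄) (scale w α) (scale_injective w α)

/-- … and the induced `ℂ`-normed-space structure. [folklore] -/
instance instNormedSpace : NormedSpace ℂ (WSup w α 𝔄) := NormedSpace.induced ℂ (WSup w α 𝔄) (Λ → 𝔄) (scale w α)

/-- The norm is the flat sup norm of the scaled field. [folklore] -/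
theorem norm_def (A : WSup w α 𝔄) : ‖A‖ = ‖scale w α A‖ := rfl

/-- Each weighted component is below the norm: `(w b)^α·‖A b‖ ≤ ‖A‖`. [folklore] -/
theorem norm_apply_le (A : WSup w α 𝔄) (b : Λ) : w b ^ α * ‖A b‖ ≤ ‖A‖ := by
  rw [norm_def, ← abs_of_pos (hw.out b), ← norm_scale_apply]
  exact norm_le_pi_norm (scale w α A) b

/-- `‖A‖ ≤ r ↔ ∀ b, (w b)^α·‖A b‖ ≤ r` (`0 ≤ r`). [folklore] -/
theorem norm_le_iff {A : WSup w α 𝔄} {r : ℝ} (hr : 0 ≤ r) : ‖A‖ ≤ r ↔ ∀ b, w b ^ α * ‖A b‖ ≤ r := by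
  rw [norm_def, pi_norm_le_iff_of_nonneg hr]
  refine forall_congr' fun b => ?_
  rw [norm_scale_apply, abs_of_pos (hw.out b)]

/-- **(97) ⇔ (98).**  `‖A‖ < r ↔ ∀ b, (w b)^α·‖A b‖ < r` (`0 < r`): «`|·| < C·(Lʲη)^{−α}` on every `Ω_j`» is the same as
«weighted sup `< C`» (for Bałaban's `w b = L^{j(b)}η`). [folklore] -/
theorem norm_lt_iff {A : WSup w α 𝔄} {r : ℝ} (hr : 0 < r) : ‖A‖ < r ↔ ∀ b, w b ^ α * ‖A b‖ < r := by
  rw [norm_def, pi_norm_lt_iff hr]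
  refine forall_congr' fun b => ?_
  rw [norm_scale_apply, abs_of_pos (hw.out b)]

/-! ## §2 The identity as a continuous linear equivalence with the flat space (finite volume) -/

/-- Crude comparison constants (finite sums dominate each term; only their finiteness matters). [folklore] -/
theorem norm_toPi_le (A : WSup w α 𝔄) : ‖toPi w α A‖ ≤ (∑ b, (w b ^ α)⁻¹) * ‖A‖ := by
  have hS : 0 ≤ ∑ b, (w b ^ α)⁻¹ := Finset.sum_nonneg fun b _ => (inv_pos.2 (pow_pos (hw.out b) α)).le
  refine (pi_norm_le_iff_of_nonneg (mul_nonneg hS (norm_nonneg _))).2 fun b => ?_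
  have hwb : 0 < w b ^ α := pow_pos (hw.out b) α
  have h1 : ‖A b‖ ≤ (w b ^ α)⁻¹ * ‖A‖ := by
    rw [le_inv_mul_iff₀ hwb]
    exact norm_apply_le w α A b
  have h2 : (w b ^ α)⁻¹ ≤ ∑ b', (w b' ^ α)⁻¹ :=
    Finset.single_le_sum (f := fun b' => (w b' ^ α)⁻¹) (fun b' _ => (inv_pos.2 (pow_pos (hw.out b') α)).le)
      (Finset.mem_univ b)
  exact h1.trans (mul_le_mul_of_nonneg_right h2 (norm_nonneg _))

/-- … and the other direction. [folklore] -/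
theorem norm_ofPi_le (A : Λ → 𝔄) : ‖((toPi w α).symm A : WSup w α 𝔄)‖ ≤ (∑ b, w b ^ α) * ‖A‖ := by
  have hS : 0 ≤ ∑ b, w b ^ α := Finset.sum_nonneg fun b _ => (pow_pos (hw.out b) α).le
  refine (norm_le_iff w α (mul_nonneg hS (norm_nonneg _))).2 fun b => ?_
  have h1 : w b ^ α ≤ ∑ b', w b' ^ α :=
    Finset.single_le_sum (f := fun b' => w b' ^ α) (fun b' _ => (pow_pos (hw.out b') α).le) (Finset.mem_univ b)
  calc w b ^ α * ‖((toPi w α).symm A : WSup w α 𝔄) b‖ = w b ^ α * ‖A b‖ := rfl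
    _ ≤ (∑ b', w b' ^ α) * ‖A‖ :=
        mul_le_mul h1 (norm_le_pi_norm A b) (norm_nonneg _) hS

/-- **THE IDENTITY IS A CONTINUOUS LINEAR EQUIVALENCE** `WSup w α 𝔄 ≃L[ℂ] (Λ → 𝔄)`: the weighted spaces have the same
topology, hence the same differentiable∕analytic maps, as the flat product. [folklore] -/
def toPiL : WSup w α 𝔄 ≃L[ℂ] (Λ → 𝔄) :=
  ContinuousLinearEquiv.equivOfInverse
    ((toPi w α).toLinearMap.mkContinuous (∑ b, (w b ^ α)⁻¹) (norm_toPi_le w α))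
    ((toPi w α).symm.toLinearMap.mkContinuous (∑ b, w b ^ α) (norm_ofPi_le w α))
    (fun _ => rfl) (fun _ => rfl)

/-- `toPiL` is the identity on underlying functions. [folklore] -/
theorem toPiL_apply (A : WSup w α 𝔄) (b : Λ) : toPiL w α A b = A b := rfl

/-- `toPiL.symm` is the identity on underlying functions. [folklore] -/
theorem toPiL_symm_apply (A : Λ → 𝔄) (b : Λ) : ((toPiL w α).symm A : WSup w α 𝔄) b = A b := rfl

/-- The ball of the weighted norm is the weighted ball of f2b, read through the identity. [folklore] -/
theorem preimage_wBall {r : ℝ} (hr : 0 < r) :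
    (toPiL w α) ⁻¹' {A : Λ → 𝔄 | ∀ b, w b ^ α * ‖A b‖ < r} = {Y : WSup w α 𝔄 | ‖Y‖ < r} := by
  ext Y
  simp only [mem_preimage, mem_setOf_eq, norm_lt_iff w α hr]
  rfl

/-- **TRANSFER OF DIFFERENTIABILITY.**  A map between weighted spaces is ℂ-differentiable on the weighted ball iff its
flat-coordinate expression is ℂ-differentiable on the flat weighted ball. [folklore] -/
theorem differentiableOn_iff {Λ' : Type*} [Fintype Λ'] {𝔅 : Type*} [NormedAddCommGroup 𝔅] [NormedSpace ℂ 𝔅]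
    (w' : Λ' → ℝ) (α' : ℕ) [Fact (∀ b, 0 < w' b)] (G : (Λ → 𝔄) → (Λ' → 𝔅)) {r : ℝ} (hr : 0 < r) :
    DifferentiableOn ℂ (fun Y : WSup w α 𝔄 => ((toPiL w' α').symm (G (toPiL w α Y)) : WSup w' α' 𝔅))
        {Y : WSup w α 𝔄 | ‖Y‖ < r} ↔
      DifferentiableOn ℂ G {A : Λ → 𝔄 | ∀ b, w b ^ α * ‖A b‖ < r} := by
  rw [← preimage_wBall w α hr]
  have h1 : (fun Y : WSup w α 𝔄 => ((toPiL w' α').symm (G (toPiL w α Y)) : WSup w' α' 𝔅)) =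
      (toPiL w' α').symm ∘ (G ∘ toPiL w α) := rfl
  rw [h1]
  constructor
  · intro H
    have H1 : DifferentiableOn ℂ (G ∘ toPiL w α) ((toPiL (𝔄 := 𝔄) w α) ⁻¹' {A | ∀ b, w b ^ α * ‖A b‖ < r}) :=
      ((toPiL (𝔄 := 𝔅) w' α').symm.comp_differentiableOn_iff).1 H
    exact ((toPiL (𝔄 := 𝔄) w α).comp_right_differentiableOn_iff).1 H1
  · intro H
    have H1 : DifferentiableOn ℂ (G ∘ toPiL w α) ((toPiL (𝔄 := 𝔄) w α) ⁻¹' {A | ∀ b, w b ^ α * ‖A b‖ < r}) :=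
      ((toPiL (𝔄 := 𝔄) w α).comp_right_differentiableOn_iff).2 H
    exact ((toPiL (𝔄 := 𝔅) w' α').symm.comp_differentiableOn_iff).2 H1

end WSup

/-! ## §3 (P4)'s (98) SHAPE for the `∇`-free plaquette part, LITERALLY as `Prop4Hyp` between the weighted spaces -/

section Levels

open WSup

variable [DecidableEq Λ] {P : Type*} (Pl : Finset P) (φ : P → (Λ → 𝔄) → ℂ) (supp : P → Finset Λ)
  (w : Λ → ℝ) (W : P → ℝ) [hw : Fact (∀ b, 0 < w b)]

/-- **END-II's `hW` SHAPE AT THE LIVE LEVELS, `∇`-FREE PLAQUETTE PART.**  Data as in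
`ShellMeasureGradientTailLevels.weighted_locGrad_le` (positive bond weights `w`, plaquette weights `W p ≤ w b ≤ Lc·W p`
on `supp p`, local functionals `φ_p` ANALYTIC on the weighted polydisc `{∀ b ∈ supp p, ‖A b‖ < ε∕W p}` with the
(40)-shape cubic binder `κ∕W p`, locality, incidence `≤ m`).  Conclusion: the bond-local gradient of `V = Σ_p φ_p`,
read from `(fields, |·|_{(−1)})` to `(gradient fields, |·|_{(−3)})`, satisfies
`Prop4Hyp W′ (8·κ·m·Lc⁴) (ε∕2)` — [Balaban1985Variational] (98) TYPE for this part, with `C₄ = 8κ·m·Lc⁴` VOLUME-FREE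
and k-UNIFORM and `a₃ = ε∕2`.  Nothing printed is asserted; the `∇`-part, the HD-dressing and the [dict] are NOT
here. [folklore] -/
theorem prop4Hyp_locGrad_levels {ε κ Lc : ℝ} {m : ℕ} (hε : 0 < ε) (hκ : 0 ≤ κ) (hLc1 : 1 ≤ Lc)
    (hW : ∀ p ∈ Pl, 0 < W p)
    (hWw : ∀ p ∈ Pl, ∀ b ∈ supp p, W p ≤ w b) (hwW : ∀ p ∈ Pl, ∀ b ∈ supp p, w b ≤ Lc * W p)
    (ha : ∀ p ∈ Pl, AnalyticOnNhd ℂ (φ p) {A : Λ → 𝔄 | ∀ b' ∈ supp p, ‖A b'‖ < ε / W p})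
    (hcub : ∀ p ∈ Pl, ∀ (A : Λ → 𝔄) (σ : ℝ), 0 ≤ σ → σ < ε / W p → (∀ b' ∈ supp p, ‖A b'‖ ≤ σ) →
      ‖φ p A‖ ≤ κ / W p * σ ^ 3)
    (hloc : ∀ p ∈ Pl, ∀ A : Λ → 𝔄, ∀ b ∉ supp p, ∀ X : 𝔄, φ p (A + Pi.single b X) = φ p A)
    (hm : ∀ b : Λ, (Pl.filter (fun p => b ∈ supp p)).card ≤ m) :
    Prop4Hyp (fun Y : WSup w 1 𝔄 =>
        ((toPiL w 3).symm (locGrad (fun A => ∑ p ∈ Pl, φ p A) (toPiL w 1 Y)) : WSup w 3 (𝔄 →L[ℂ] ℂ)))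
      (8 * κ * m * Lc ^ 4) (ε / 2) where
  quad Y hY := by
    have hC : 0 ≤ 8 * κ * m * Lc ^ 4 * ‖Y‖ ^ 2 := by
      have : 0 ≤ Lc := zero_le_one.trans hLc1
      positivity
    refine (norm_le_iff w 3 hC).2 fun b => ?_
    have hA : ∀ b, w b * ‖(toPiL w 1 Y) b‖ ≤ ‖Y‖ := fun b => by
      have h := norm_apply_le w 1 Y b
      rw [pow_one] at h
      exact h
    have h := weighted_locGrad_le Pl φ supp w W hκ hLc1 (fun b => hw.out b) hW hWw hwW
      (fun p hp => (ha p hp).differentiableOn) hcub hloc hm (norm_nonneg Y) hA (by linarith) b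
    exact h
  differentiableOn := by
    have h2 : 0 < ε / 2 := by positivity
    rw [differentiableOn_iff w 1 w 3 (fun A => locGrad (fun A => ∑ p ∈ Pl, φ p A) A) h2]
    have h := differentiableOn_locGrad_wBall Pl φ supp w W hW hWw ha
    refine h.mono fun A hA b => ?_
    have := hA b
    rw [pow_one] at this
    linarith

end Levels

/-! ## §4 Bookkeeping: `Prop4Hyp` under a norm-non-increasing linear change of the source space -/

/-- If `W` has the (98) shape `Prop4Hyp W C a` on `𝒴` and `T : 𝒴′ →L[ℂ] 𝒴` does not increase norms, then `W ∘ T` has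
the (98) shape on `𝒴′` with the SAME constants.  Use: the max-normed field space `(max{|·|_{(−1)}, |∇·|_{(−2)}})`, once
the `∇`-datum is fixed, maps norm-non-increasingly onto `(|·|_{(−1)})` by the identity, so §3's statement IS (98)'s for
the `∇`-free part. [folklore] -/
theorem Prop4Hyp.comp_of_norm_le {𝒴 𝒴' 𝒵 : Type*} [NormedAddCommGroup 𝒴] [NormedSpace ℂ 𝒴]
    [NormedAddCommGroup 𝒴'] [NormedSpace ℂ 𝒴'] [NormedAddCommGroup 𝒵] [NormedSpace ℂ 𝒵]
    {W : 𝒴 → 𝒵} {C a : ℝ} (hW : Prop4Hyp W C a) (hC : 0 ≤ C) (T : 𝒴' →L[ℂ] 𝒴) (hT : ∀ y, ‖T y‖ ≤ ‖y‖) :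
    Prop4Hyp (W ∘ T) C a where
  quad y hy := by
    have h1 : ‖T y‖ < a := (hT y).trans_lt hy
    calc ‖(W ∘ T) y‖ = ‖W (T y)‖ := rfl
      _ ≤ C * ‖T y‖ ^ 2 := hW.quad (T y) h1
      _ ≤ C * ‖y‖ ^ 2 := by
          gcongr
          exact hT y
  differentiableOn := by
    have hmaps : MapsTo T {y : 𝒴' | ‖y‖ < a} {Y : 𝒴 | ‖Y‖ < a} := fun y hy => (hT y).trans_lt hy
    exact hW.differentiableOn.comp T.differentiable.differentiableOn hmaps

end Summit.QuantumFields.BalabanUV.T4Continuum.ShellMeasureMultiGridNorms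

end
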